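import Literature.MathematicalPhysics.QuantumChemistry.T2OperatorBound
import Literature.MathematicalPhysics.QuantumChemistry.WeinholdWilsonInequalities
import HarnessLib

/-!
# An operator bound for the `T2′` block: `λ_max(T2′) ≤ N(r + 2) + 1` on the `PQGT1T2′`-feasible set

Topic `Literature/MathematicalPhysics/QuantumChemistry`; companion of `T2OperatorBound.lean`
(`N(r+2) · 1 − T2 ⪰ 0`), `WeinholdWilsonInequalities.lean` (`1 − γ ⪰ 0` on the DQG-feasible set,
`IsDQGFeasible.one_sub_one_posSemidef'`) and `ThreeIndexRelaxationBound.lean` (the bordered matrix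
`T2′ = ( T2 X ; X† γ )`, Nakata et al. 2008 §II.B, `t2PrimeMap`). HONEST FRAMING (cell chem-oracle,
LADDER-CHEM I-TYPE slot 08): statements about a finite model Hamiltonian's reduced density matrices and
their semidefinite relaxations; this file certifies no number.

THE PRINTED STARTING POINT. Chaykin, Jansson, Keil, Lange, Ohlhus, Rump (2016) §4.1 eq. (4.6):
"`λmax(T2′) ≤ N(r(r−N)+1)`", the trace constant `tr(T2′) = tr(T2) + tr(γ)` (4.5), used as the a-priori
`x̄_j` of their Theorem 2 (5.19) "upper bounds for the maximal eigenvalues of the primal feasible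
solution". [cite: ChaykinEtAl2016RigorousESC, §4.1 eqs. (4.5)-(4.6), p. 15; §5 Thm 2 (5.19), p. 22]

WHAT IS PROVED HERE (0 sorry, no definition, no named fact) — SHARPER, proved here and NOT in print:

* `posSemidef_add_smul_one_sub_fromBlocks` — the two-block form of the engine of
  `GarrodPercusEigenvalueBound.lean`: if `( A B ; C D ) ⪰ 0`, `A ⪯ a · 1`, `D ⪯ d · 1` (`a, d ≥ 0`),
  then `( A B ; C D ) ⪯ (a + d) · 1` (Gram factor, triangle inequality, Cauchy–Schwarz);
* **`IsDQGT1T2PrimeFeasible.posSemidef_smul_one_sub_t2PrimeMap`** — on the `PQGT1T2′`-feasible set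
  `(N(r+2) + 1) · 1 − t2PrimeMap γ Γ ⪰ 0`: the blocks of `T2′ ⪰ 0` are `T2 ⪯ N(r+2) · 1`
  (`T2OperatorBound.lean`) and `γ ⪯ 1` (Pauli). For `|ι| = 56, N = 14` the constant is `813` against
  the printed `32942`; for `|ι| = 40, N = 30` it is `1261` against `12030`.
-/

noncomputable section

namespace Literature.MathematicalPhysics.QuantumChemistry

open Matrix Finset Literature.MathematicalPhysics.QuantumLattice
open scoped ComplexOrder

/-! ### The two-block engine -/

section TwoBlocks

variable {m n : Type*} [Fintype m] [Fintype n] [DecidableEq m] [DecidableEq n]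

/-- `u* · u = Σ_p ‖u_p‖²` (as a complex number; plumbing). [folklore] -/
private theorem star_dotProduct_self_eq_ofReal_sum₂ {α : Type*} [Fintype α] (u : α → ℂ) :
    star u ⬝ᵥ u = ((∑ p, ‖u p‖ ^ 2 : ℝ) : ℂ) := by
  rw [dotProduct, Complex.ofReal_sum]
  refine Finset.sum_congr rfl fun p _ => ?_
  rw [Pi.star_apply, Complex.star_def, Complex.conj_mul', Complex.ofReal_pow]

/-- A Löwner bound `w · 1 − A ⪰ 0` on one vector: `Re (c* A c) ≤ w · Σ_j ‖c_j‖²` (plumbing). [folklore] -/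
private theorem re_quadForm_le_of_smul_one_sub₂ {α : Type*} [Fintype α] [DecidableEq α]
    {A : Matrix α α ℂ} {w : ℝ} (h : ((w : ℂ) • (1 : Matrix α α ℂ) - A).PosSemidef) (c : α → ℂ) :
    (star c ⬝ᵥ (A *ᵥ c)).re ≤ w * ∑ j, ‖c j‖ ^ 2 := by
  have h0 := Complex.nonneg_iff.mp (h.dotProduct_mulVec_nonneg c)
  rw [sub_mulVec, smul_mulVec, one_mulVec, dotProduct_sub, dotProduct_smul, smul_eq_mul,
    star_dotProduct_self_eq_ofReal_sum₂, ← Complex.ofReal_mul, Complex.sub_re, Complex.ofReal_re] at h0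
  linarith [h0.1]

/-- **Two-block engine**: for a positive semidefinite block matrix `( A B ; C D )` with
`a · 1 − A ⪰ 0`, `d · 1 − D ⪰ 0` (`a, d ≥ 0`), `(a + d) · 1 − ( A B ; C D ) ⪰ 0` — i.e.
`λ_max ≤ λ_max(A) + λ_max(D)` for PSD block matrices; the two-block case of
`posSemidef_sum_smul_one_sub_of_rowBlocks` (Chaykin 2009 (3.44)–(3.45), (3.53)–(3.54) pattern).
[cite: Chaykin2009Thesis, §3.4.1 eqs. (3.44)-(3.45), (3.53)-(3.54), pp. 36-38] -/
theorem posSemidef_add_smul_one_sub_fromBlocks {A : Matrix m m ℂ} {B : Matrix m n ℂ}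
    {C : Matrix n m ℂ} {D : Matrix n n ℂ} (hM : (Matrix.fromBlocks A B C D).PosSemidef) {a d : ℝ}
    (ha : 0 ≤ a) (hd : 0 ≤ d) (hA : ((a : ℂ) • (1 : Matrix m m ℂ) - A).PosSemidef)
    (hD : ((d : ℂ) • (1 : Matrix n n ℂ) - D).PosSemidef) :
    (((a + d : ℝ) : ℂ) • (1 : Matrix (m ⊕ n) (m ⊕ n) ℂ) - Matrix.fromBlocks A B C D).PosSemidef := by
  classical
  set M := Matrix.fromBlocks A B C D with hMdef
  obtain ⟨R, hR⟩ :=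
    Literature.LinearAlgebra.Matrix.exists_eq_conjTranspose_mul_self_of_posSemidef hM
  have hquad : ∀ v : m ⊕ n → ℂ,
      star v ⬝ᵥ (M *ᵥ v) = ((∑ p, ‖(R *ᵥ v) p‖ ^ 2 : ℝ) : ℂ) := by
    intro v
    rw [hR, ← mulVec_mulVec, dotProduct_mulVec, ← star_mulVec, star_dotProduct_self_eq_ofReal_sum₂]
  let L : (m ⊕ n → ℂ) →ₗ[ℂ] EuclideanSpace ℂ (m ⊕ n) :=
    (WithLp.linearEquiv 2 ℂ (m ⊕ n → ℂ)).symm.toLinearMap ∘ₗ R.mulVecLin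
  have hLapply : ∀ v p, L v p = (R *ᵥ v) p := fun v p => rfl
  have hL : ∀ v, ‖L v‖ ^ 2 = (star v ⬝ᵥ (M *ᵥ v)).re := by
    intro v
    rw [EuclideanSpace.norm_sq_eq, hquad, Complex.ofReal_re]
    simp only [hLapply]
  have hherm : (((a + d : ℝ) : ℂ) • (1 : Matrix (m ⊕ n) (m ⊕ n) ℂ) - M).IsHermitian := by
    have h1 : (((a + d : ℝ) : ℂ) • (1 : Matrix (m ⊕ n) (m ⊕ n) ℂ)).IsHermitian := by
      rw [IsHermitian, conjTranspose_smul, conjTranspose_one, Complex.star_def, Complex.conj_ofReal]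
    exact h1.sub hM.1
  refine PosSemidef.of_dotProduct_mulVec_nonneg hherm fun x => ?_
  -- the two slices of `x`
  set u : m → ℂ := fun i => x (Sum.inl i) with hu
  set v : n → ℂ := fun j => x (Sum.inr j) with hv
  set x₁ : m ⊕ n → ℂ := Sum.elim u 0 with hx₁
  set x₂ : m ⊕ n → ℂ := Sum.elim 0 v with hx₂
  have hx : x = x₁ + x₂ := by
    ext p
    rcases p with i | j
    · simp [hx₁, hx₂, hu]
    · simp [hx₁, hx₂, hv]
  have hq₁ : star x₁ ⬝ᵥ (M *ᵥ x₁) = star u ⬝ᵥ (A *ᵥ u) := by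
    rw [hMdef, fromBlocks_mulVec]
    simp [hx₁, dotProduct, Fintype.sum_sum_type, mulVec_zero]
  have hq₂ : star x₂ ⬝ᵥ (M *ᵥ x₂) = star v ⬝ᵥ (D *ᵥ v) := by
    rw [hMdef, fromBlocks_mulVec]
    simp [hx₂, dotProduct, Fintype.sum_sum_type, mulVec_zero]
  set mu : ℝ := ∑ i, ‖u i‖ ^ 2 with hmu
  set mv : ℝ := ∑ j, ‖v j‖ ^ 2 with hmv
  have hmu0 : 0 ≤ mu := Finset.sum_nonneg fun i _ => sq_nonneg _
  have hmv0 : 0 ≤ mv := Finset.sum_nonneg fun j _ => sq_nonneg _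
  have hsum : mu + mv = ∑ p, ‖x p‖ ^ 2 := by
    rw [Fintype.sum_sum_type]
  have h₁ : ‖L x₁‖ ≤ Real.sqrt a * Real.sqrt mu := by
    have h1 : ‖L x₁‖ ^ 2 ≤ a * mu := by
      rw [hL, hq₁]; exact re_quadForm_le_of_smul_one_sub₂ hA u
    calc ‖L x₁‖ = Real.sqrt (‖L x₁‖ ^ 2) := (Real.sqrt_sq (norm_nonneg _)).symm
      _ ≤ Real.sqrt (a * mu) := Real.sqrt_le_sqrt h1
      _ = Real.sqrt a * Real.sqrt mu := Real.sqrt_mul ha _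
  have h₂ : ‖L x₂‖ ≤ Real.sqrt d * Real.sqrt mv := by
    have h1 : ‖L x₂‖ ^ 2 ≤ d * mv := by
      rw [hL, hq₂]; exact re_quadForm_le_of_smul_one_sub₂ hD v
    calc ‖L x₂‖ = Real.sqrt (‖L x₂‖ ^ 2) := (Real.sqrt_sq (norm_nonneg _)).symm
      _ ≤ Real.sqrt (d * mv) := Real.sqrt_le_sqrt h1
      _ = Real.sqrt d * Real.sqrt mv := Real.sqrt_mul hd _
  have hmain : (star x ⬝ᵥ (M *ᵥ x)).re ≤ (a + d) * ∑ p, ‖x p‖ ^ 2 := by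
    have htri : ‖L x‖ ≤ ‖L x₁‖ + ‖L x₂‖ := by
      rw [hx, map_add]; exact norm_add_le _ _
    have hle : ‖L x‖ ≤ Real.sqrt a * Real.sqrt mu + Real.sqrt d * Real.sqrt mv :=
      htri.trans (add_le_add h₁ h₂)
    have h0 : 0 ≤ ‖L x‖ := norm_nonneg _
    have hsq : ‖L x‖ ^ 2 ≤ (Real.sqrt a * Real.sqrt mu + Real.sqrt d * Real.sqrt mv) ^ 2 := by
      nlinarith
    have hcs : (Real.sqrt a * Real.sqrt mu + Real.sqrt d * Real.sqrt mv) ^ 2 ≤ (a + d) * (mu + mv) := by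
      have ea := Real.sq_sqrt ha
      have ed := Real.sq_sqrt hd
      have eu := Real.sq_sqrt hmu0
      have ev := Real.sq_sqrt hmv0
      nlinarith [sq_nonneg (Real.sqrt a * Real.sqrt mv - Real.sqrt d * Real.sqrt mu)]
    rw [← hL, ← hsum]
    exact hsq.trans hcs
  have him : (star x ⬝ᵥ (M *ᵥ x)).im = 0 := by rw [hquad, Complex.ofReal_im]
  rw [sub_mulVec, smul_mulVec, one_mulVec, dotProduct_sub, dotProduct_smul, smul_eq_mul,
    star_dotProduct_self_eq_ofReal_sum₂, ← Complex.ofReal_mul, Complex.nonneg_iff, Complex.sub_re,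
    Complex.ofReal_re, Complex.sub_im, Complex.ofReal_im, him, sub_zero]
  exact ⟨by linarith, rfl⟩

end TwoBlocks

/-! ### The operator bound for `T2′` -/

section T2Prime

variable {ι : Type*} [LinearOrder ι] [Fintype ι] {N : ℕ} {γ : Matrix ι ι ℂ}
  {Γ : Matrix (ι × ι) (ι × ι) ℂ}

/-- **`λ_max(T2′) ≤ N(r + 2) + 1` on the `PQGT1T2′`-feasible set**, as
`(N(r+2) + 1) · 1 − t2PrimeMap γ Γ ⪰ 0` (`r = |ι|`): the bordered matrix `T2′ = ( T2 X ; X† γ ) ⪰ 0`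
has diagonal blocks `T2 ⪯ N(r+2) · 1` (`IsDQGT1T2PrimeFeasible.posSemidef_smul_one_sub_t2Map`) and
`γ ⪯ 1` (`IsDQGFeasible.one_sub_one_posSemidef'`). SHARPENS the printed trace constant
`λmax(T2′) ≤ N(r(r−N)+1)` of (4.6); proved here, not printed (printed form:
`IsDQGT1T2PrimeFeasible.trace_smul_one_sub_t2PrimeMap_posSemidef`, `T2ConditionTrace.lean`).
[cite: ChaykinEtAl2016RigorousESC, §4.1 eq. (4.6), p. 15] -/
theorem IsDQGT1T2PrimeFeasible.posSemidef_smul_one_sub_t2PrimeMap (h : IsDQGT1T2PrimeFeasible N γ Γ) :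
    (((N : ℂ) * (Fintype.card ι + 2) + 1) • (1 : Matrix ((ι × ι × ι) ⊕ ι) ((ι × ι × ι) ⊕ ι) ℂ) -
      t2PrimeMap γ Γ).PosSemidef := by
  have hM : (Matrix.fromBlocks (t2Map γ Γ)
      (Matrix.of fun (I : ι × ι × ι) (l : ι) => Γ (I.1, I.2.1) (l, I.2.2))
      (Matrix.of fun (l : ι) (I : ι × ι × ι) => Γ (l, I.2.2) (I.1, I.2.1)) γ).PosSemidef := h.t2Prime_psd
  have hA : ((((N : ℝ) * (Fintype.card ι + 2) : ℝ) : ℂ) • (1 : Matrix (ι × ι × ι) (ι × ι × ι) ℂ) -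
      t2Map γ Γ).PosSemidef := by
    have h1 := h.posSemidef_smul_one_sub_t2Map
    push_cast
    exact h1
  have hD : (((1 : ℝ) : ℂ) • (1 : Matrix ι ι ℂ) - γ).PosSemidef := by
    rw [Complex.ofReal_one, one_smul]
    exact h.toIsDQGFeasible.one_sub_one_posSemidef'
  have ha : 0 ≤ (N : ℝ) * (Fintype.card ι + 2) := by positivity
  have h2 := posSemidef_add_smul_one_sub_fromBlocks hM ha zero_le_one hA hD
  have hcast : ((((N : ℝ) * (Fintype.card ι + 2) + 1 : ℝ)) : ℂ) = (N : ℂ) * (Fintype.card ι + 2) + 1 := by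
    push_cast; ring
  rw [hcast] at h2
  exact h2

end T2Prime

end Literature.MathematicalPhysics.QuantumChemistry

end
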